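import Summits.CriticalPhenomena.SAWScalingLimit.Theorems.SAWDefectDecoherenceBoundaryClosureRTransportReflection
import Summits.CriticalPhenomena.SAWScalingLimit.Theorems.SAWDefectDecoherenceBoundaryClosureRGateStabilityReflection
import HarnessLib

/-!
# `BoundaryClosureR` (stmt-CriticalPhenomena-14004), line `polygon-parity-squeeze`, stub
# `transportRigidity` (E), part F4a: the conformal chart at a flat boundary point

For the identification step (E) of mechanism (A) we need, at every flat boundary point `z₀` of
the polygonal domain `Ω` (direction `n`, flat disc `B(z₀, s)` avoiding the root), a CHART:

* `exists_frameChart` — the Schwarz reflection `G` of the frame `Φ` across the side (holomorphic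
  and injective on `B(z₀, s)`, `= Φ*` on `closure Ω ∩ B`, `im G > 0` only on `Ω`, `im G = 0` only
  on the side, `G' ≠ 0`) together with a holomorphic logarithm `M` of `G'` on a concentric
  `B(z₀, s₁)` which AGREES with the given continuous logarithm `L` of `Φ'` on `Ω ∩ B(z₀, s₁)`;
* `chart_tendsto` — hence `L → M z` within `Ω` at every point `z` of the closed half-disc;
* `testFunction_transport` — for a test function `φ` supported in `G(B(z₀, s₁/4))`, the
  transported function `Ψ = (φ ∘ G) · e^{(3/8) M}` (extended by `0`) is `C^∞` with compact
  support in `closedBall z₀ (s₁/4)` (injectivity of `G` kills `φ ∘ G` on the annulus).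

References: Pommerenke, *Boundary Behaviour of Conformal Maps* (1992), Thm. 2.6; Hörmander,
*An Introduction to Complex Analysis in Several Variables* (1973), §1.1.
-/

noncomputable section

open scoped Topology ComplexConjugate ContDiff
open Filter Set Metric Complex
open UpperHalfPlane (upperHalfPlaneSet)
open Literature.Probability.RandomPlanarGeometry

namespace Summit.CriticalPhenomena.SAWScalingLimit.Theorems.PolygonParitySqueeze

namespace Transport

/-! ### 1. The chart at a flat point -/

/-- **The conformal chart at a flat boundary point.**  Let `Φ : Ω → ℍₒ` be a frame of the
Dobrushin domain `D` with injective Carathéodory extension `Φ*` (continuous and injective on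
`closure Ω ∖ {root}`, real on `∂Ω`), `L` a continuous logarithm of `Φ'` on `Ω`, and let `Ω` be
flat of direction `n` in `B(z₀, s)` with the root outside `closedBall z₀ s`.  Then the Schwarz
reflection `G` of `Φ` across the side is holomorphic and injective on `B(z₀, s)`, equal to `Φ*` on
`closure Ω ∩ B`, with `im G > 0` only on `Ω`, `im G = 0` only on the side and `G' ≠ 0`; and on a
concentric `B(z₀, s₁)` there is a holomorphic logarithm `M` of `G'` with `M = L` on `Ω ∩ B(z₀,s₁)`.
[cite: PommerenkeBBCM1992, Thm. 2.6] -/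
theorem exists_frameChart (D : DobrushinDomain) (Φ : ConformalEquiv D.carrier upperHalfPlaneSet)
    {Φs : ℂ → ℂ} (hΦsc : ContinuousOn Φs (closure D.carrier \ {D.pt 0}))
    (hΦse : EqOn Φs Φ D.carrier) (hΦsr : ∀ p ∈ frontier D.carrier, (Φs p).im = 0)
    (hΦsi : InjOn Φs (closure D.carrier \ {D.pt 0}))
    {L : ℂ → ℂ} (hL : ContinuousOn L D.carrier)
    (hexp : ∀ z ∈ D.carrier, Complex.exp (L z) = deriv Φ z)
    {z₀ n : ℂ} (hn : ‖n‖ = 1) {s : ℝ} (hs : 0 < s)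
    (hflat : D.carrier ∩ ball z₀ s = {w : ℂ | 0 < ((w - z₀) * conj n).re} ∩ ball z₀ s)
    (h0 : D.pt 0 ∉ closedBall z₀ s) :
    ∃ (s₁ : ℝ) (G M : ℂ → ℂ), 0 < s₁ ∧ s₁ ≤ s ∧
      DifferentiableOn ℂ G (ball z₀ s) ∧ InjOn G (ball z₀ s) ∧
      EqOn G Φs (closure D.carrier ∩ ball z₀ s) ∧
      (∀ w ∈ ball z₀ s, 0 < (G w).im → w ∈ D.carrier) ∧
      (∀ w ∈ ball z₀ s, (G w).im = 0 → w ∈ frontier D.carrier) ∧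
      (∀ w ∈ ball z₀ s, deriv G w ≠ 0) ∧
      DifferentiableOn ℂ M (ball z₀ s₁) ∧ (∀ w ∈ ball z₀ s₁, Complex.exp (M w) = deriv G w) ∧
      EqOn M L (D.carrier ∩ ball z₀ s₁) := by
  have hU : IsOpen D.carrier := D.isOpen
  have hnn : n * conj n = 1 := by rw [mul_conj, Complex.normSq_eq_norm_sq, hn]; simp
  have hsub0 : closure D.carrier ∩ ball z₀ s ⊆ closure D.carrier \ {D.pt 0} := fun w hw =>
    ⟨hw.1, fun h => h0 (ball_subset_closedBall (mem_singleton_iff.1 h ▸ hw.2))⟩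
  -- the reflection
  obtain ⟨G, hGd, hGinj, hGeq, hGpos, hGzero, hGder⟩ := exists_flatReflection hU hn hflat
    ((Φ.differentiableOn).mono inter_subset_left) (fun w hw => Φ.mapsTo hw.1) (hΦsc.mono hsub0)
    (hΦse.mono inter_subset_left) (fun w hw => hΦsr w hw.1) (hΦsi.mono hsub0)
  -- a local logarithm of `G'`
  obtain ⟨s₁, M₀, hs₁, hs₁s, hM₀d, hM₀exp⟩ := exists_localLog hs hGd (hGder z₀ (mem_ball_self hs))
  have hb : ball z₀ s₁ ⊆ ball z₀ s := ball_subset_ball hs₁s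
  -- the flat piece `N = Ω ∩ B(z₀, s₁)`
  set N : Set ℂ := D.carrier ∩ ball z₀ s₁ with hN
  have hNflat : N = {w : ℂ | 0 < ((w - z₀) * conj n).re} ∩ ball z₀ s₁ :=
    flatDir_subball hflat (by simp) hb
  have hNpc : IsPreconnected N := by rw [hNflat]; exact isPreconnected_flatPiece z₀ n s₁
  have hopen : IsOpen (D.carrier ∩ ball z₀ s) := hU.inter isOpen_ball
  have hderiv : ∀ w ∈ N, deriv G w = deriv Φ w := by
    intro w hw
    have hev : G =ᶠ[𝓝 w] (Φ : ℂ → ℂ) := by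
      filter_upwards [hopen.mem_nhds ⟨hw.1, hb hw.2⟩] with w' hw'
      rw [hGeq ⟨subset_closure hw'.1, hw'.2⟩, hΦse hw'.1]
    exact hev.deriv_eq
  have hLexp : ∀ w ∈ N, Complex.exp (L w) = deriv G w := fun w hw => by
    rw [hderiv w hw, hexp w hw.1]
  have hM₀exp' : ∀ w ∈ N, Complex.exp (M₀ w) = deriv G w := fun w hw => hM₀exp w hw.2
  -- a base point of the flat piece
  set q : ℂ := z₀ + ((s₁ / 2 : ℝ) : ℂ) * n with hq
  have hqball : q ∈ ball z₀ s₁ := by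
    rw [mem_ball, dist_eq_norm, hq, add_sub_cancel_left, norm_mul, norm_real, hn, mul_one,
      Real.norm_eq_abs, abs_of_pos (half_pos hs₁)]
    exact half_lt_self hs₁
  have hqN : q ∈ N := by
    refine ⟨(mem_iff_of_flatDir hflat (hb hqball)).2 ?_, hqball⟩
    rw [hq, add_sub_cancel_left, mul_assoc, hnn, mul_one, ofReal_re]
    exact half_pos hs₁
  -- the normalised logarithm
  set M : ℂ → ℂ := fun w => M₀ w - M₀ q + L q with hM
  have hML : EqOn M L N :=
    localLog_eqOn hNpc (hM₀d.continuousOn.mono inter_subset_right)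
      (hL.mono inter_subset_left) hM₀exp' hLexp hqN
  refine ⟨s₁, G, M, hs₁, hs₁s, hGd, hGinj, hGeq, hGpos, hGzero, hGder, ?_, ?_, hML⟩
  · exact (hM₀d.sub_const _).add_const _
  · intro w hw
    have h1 : Complex.exp (L q) = Complex.exp (M₀ q) := by rw [hLexp q hqN, hM₀exp' q hqN]
    simp only [hM]
    rw [sub_add, Complex.exp_sub, hM₀exp w hw, Complex.exp_sub, h1, div_self (Complex.exp_ne_zero _),
      div_one]

/-- **Limits of the continuous logarithm at the closed flat piece.**  If `M` is continuous on
`B(z₀, s₁)` and agrees with `L` on `Ω ∩ B(z₀, s₁)`, then `L → M z` within `Ω` at every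
`z ∈ B(z₀, s₁)`. [folklore] -/
theorem chart_tendsto {Ω : Set ℂ} {L M : ℂ → ℂ} {z₀ : ℂ} {s₁ : ℝ}
    (hM : ContinuousOn M (ball z₀ s₁)) (hML : EqOn M L (Ω ∩ ball z₀ s₁))
    {z : ℂ} (hz : z ∈ ball z₀ s₁) : Tendsto L (𝓝[Ω] z) (𝓝 (M z)) := by
  have h1 : Tendsto M (𝓝[Ω] z) (𝓝 (M z)) :=
    (hM.continuousAt (isOpen_ball.mem_nhds hz)).tendsto.mono_left nhdsWithin_le_nhds
  refine h1.congr' ?_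
  filter_upwards [mem_nhdsWithin_of_mem_nhds (isOpen_ball.mem_nhds hz), self_mem_nhdsWithin]
    with w hw hwΩ
  exact hML ⟨hwΩ, hw⟩

/-! ### 2. The transported test function -/

/-- **The transported test function is a test function.**  Let `G` be holomorphic and injective
and `M` holomorphic on `B(z₀, s₁)`, and `φ ∈ C^∞` with `tsupport φ ⊆ G(B(z₀, s₁/4))`.  Then
`Ψ := (φ ∘ G) · e^{(3/8) M}` on `B(z₀, s₁)`, `:= 0` off it, is `C^∞` on `ℂ` with
`tsupport Ψ ⊆ closedBall z₀ (s₁/4)`: by injectivity `φ ∘ G` vanishes on the annulus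
`B(z₀, s₁) ∖ B(z₀, s₁/4)`. [folklore] -/
theorem testFunction_transport {G M Ψ φ : ℂ → ℂ} {z₀ : ℂ} {s₁ : ℝ} (hs₁ : 0 < s₁)
    (hG : DifferentiableOn ℂ G (ball z₀ s₁)) (hGinj : InjOn G (ball z₀ s₁))
    (hM : DifferentiableOn ℂ M (ball z₀ s₁))
    (hφ : ContDiff ℝ ∞ φ) (hφsupp : tsupport φ ⊆ G '' ball z₀ (s₁ / 4))
    (hΨin : ∀ z ∈ ball z₀ s₁, Ψ z = φ (G z) * Complex.exp ((3 / 8 : ℂ) * M z))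
    (hΨout : ∀ z ∉ ball z₀ s₁, Ψ z = 0) :
    ContDiff ℝ ∞ Ψ ∧ HasCompactSupport Ψ ∧ tsupport Ψ ⊆ closedBall z₀ (s₁ / 4) ∧
      (∀ z ∉ ball z₀ (s₁ / 4), Ψ z = 0) := by
  have hb4 : ball z₀ (s₁ / 4) ⊆ ball z₀ s₁ := ball_subset_ball (by linarith)
  -- `Ψ` vanishes off `B(z₀, s₁/4)`
  have hzero : ∀ z ∉ ball z₀ (s₁ / 4), Ψ z = 0 := by
    intro z hz
    by_cases hz1 : z ∈ ball z₀ s₁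
    · rw [hΨin z hz1]
      have hGz : G z ∉ tsupport φ := by
        intro h
        obtain ⟨z', hz', hGz'⟩ := hφsupp h
        exact hz (hGinj (hb4 hz') hz1 hGz' ▸ hz')
      rw [image_eq_zero_of_notMem_tsupport hGz, zero_mul]
    · exact hΨout z hz1
  have hsupp : tsupport Ψ ⊆ closedBall z₀ (s₁ / 4) := by
    refine closure_minimal (fun z hz => ?_) isClosed_closedBall
    by_contra h
    exact hz (hzero z fun h' => h (ball_subset_closedBall h'))
  have hcpt : HasCompactSupport Ψ :=
    HasCompactSupport.intro (isCompact_closedBall z₀ (s₁ / 4)) fun z hz =>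
      hzero z fun h => hz (ball_subset_closedBall h)
  -- smoothness
  have hformula : ContDiffOn ℝ ∞ (fun z => φ (G z) * Complex.exp ((3 / 8 : ℂ) * M z)) (ball z₀ s₁) := by
    have hG' : ContDiffOn ℝ ∞ G (ball z₀ s₁) := (hG.contDiffOn isOpen_ball).restrict_scalars ℝ
    have hM' : ContDiffOn ℝ ∞ (fun z => Complex.exp ((3 / 8 : ℂ) * M z)) (ball z₀ s₁) :=
      (((hM.const_mul (3 / 8 : ℂ)).cexp).contDiffOn isOpen_ball).restrict_scalars ℝ
    exact (hφ.comp_contDiffOn hG').mul hM'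
  have hsmooth : ContDiff ℝ ∞ Ψ := by
    rw [contDiff_iff_contDiffAt]
    intro z
    by_cases hz : z ∈ ball z₀ s₁
    · have hev : Ψ =ᶠ[𝓝 z] fun z => φ (G z) * Complex.exp ((3 / 8 : ℂ) * M z) := by
        filter_upwards [isOpen_ball.mem_nhds hz] with w hw
        exact hΨin w hw
      exact (hformula.contDiffAt (isOpen_ball.mem_nhds hz)).congr_of_eventuallyEq hev
    · have hz4 : z ∈ (closedBall z₀ (s₁ / 4))ᶜ := by
        intro h
        exact hz (closedBall_subset_ball (by linarith) h)
      have hev : Ψ =ᶠ[𝓝 z] fun _ => 0 := by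
        filter_upwards [isClosed_closedBall.isOpen_compl.mem_nhds hz4] with w hw
        exact hzero w fun h => hw (ball_subset_closedBall h)
      exact (contDiffAt_const (c := (0 : ℂ))).congr_of_eventuallyEq hev
  exact ⟨hsmooth, hcpt, hsupp, hzero⟩

/-! ### 3. Registered form -/

/-- **Registered helper `transport_frameChart`** (∀-closed form of `exists_frameChart`; sub-goal
F4a of stub `transportRigidity` (E), crux stmt-CriticalPhenomena-14004, line
`polygon-parity-squeeze`). [cite: PommerenkeBBCM1992, Thm. 2.6] -/
theorem transport_frameChart : ∀ (D : DobrushinDomain) (Φ : ConformalEquiv D.carrier UpperHalfPlane.upperHalfPlaneSet) (Φs L : ℂ → ℂ) (z₀ n : ℂ) (s : ℝ), ContinuousOn Φs (closure D.carrier \ {D.pt 0}) → Set.EqOn Φs Φ D.carrier → (∀ p ∈ frontier D.carrier, (Φs p).im = 0) → Set.InjOn Φs (closure D.carrier \ {D.pt 0}) → ContinuousOn L D.carrier → (∀ z ∈ D.carrier, Complex.exp (L z) = deriv Φ z) → ‖n‖ = 1 → 0 < s → D.carrier ∩ Metric.ball z₀ s = {w : ℂ | 0 < ((w - z₀) * (starRingEnd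 ℂ) n).re} ∩ Metric.ball z₀ s → D.pt 0 ∉ Metric.closedBall z₀ s → ∃ (s₁ : ℝ) (G M : ℂ → ℂ), 0 < s₁ ∧ s₁ ≤ s ∧ DifferentiableOn ℂ G (Metric.ball z₀ s) ∧ Set.InjOn G (Metric.ball z₀ s) ∧ Set.EqOn G Φs (closure D.carrier ∩ Metric.ball z₀ s) ∧ (∀ w ∈ Metric.ball z₀ s, 0 < (G w).im → w ∈ D.carrier) ∧ (∀ w ∈ Metric.ball z₀ s, (G w).im = 0 → w ∈ frontier D.carrier) ∧ (∀ w ∈ Metric.ball z₀ s, deriv G w ≠ 0) ∧ DifferentiableOn ℂ M (Metric.ball z₀ s₁) ∧ (∀ w ∈ Metric.ball z₀ s₁, Complex.exp (M w) = deriv G w) ∧ Set.EqOn M L (D.carrier ∩ Metric.ball z₀ s₁) :=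
  fun D Φ _Φs _L _z₀ _n _s hΦsc hΦse hΦsr hΦsi hL hexp hn hs hflat h0 =>
    exists_frameChart D Φ hΦsc hΦse hΦsr hΦsi hL hexp hn hs hflat h0

end Transport

end Summit.CriticalPhenomena.SAWScalingLimit.Theorems.PolygonParitySqueeze
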